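import Summits.CriticalPhenomena.PercolationContinuityZ3.Theorems.PercNearOneGluingNoHeavyPcintBSMRPieces3M
import Summits.CriticalPhenomena.PercolationContinuityZ3.Theorems.PercNearOneGluingNoHeavyPcintBSMRFast3S
import HarnessLib

/-!
# PCINT lane, PHASE 9 (block renewal with reach-3 pieces), SITE version: vertex-mask glue for the 261 pieces

Cell `prim-pcint`, seat `prim-pcint-1` (gen 17); memo `run/shared/lean/prim/pcint/T-FIBRE-ROUTE.md` §PHASE 9.

Duplicate-free vertex bit lists of the reach-3 pieces `BSMR.pc3` and the instance-ready bridge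
**`BSMR.certLHSVz_pc3_eq_certFastMS`** (`BSMX.certLHSVz` with the true shared-vertex count `BSMX.SV` equals the
cast of `BSMR.certFastMS` on the reward box `[-6,6]^2`).
-/

namespace Summit.CriticalPhenomena.PercolationContinuityZ3.Theorems.Pcint.BSMR

open Summit.CriticalPhenomena.PercolationContinuityZ3.Theorems.Pcint.BSMX
  Summit.CriticalPhenomena.PercolationContinuityZ3.Theorems.Pcint.BSM

set_option maxRecDepth 65536 in
/-- The vertex bit lists of the pieces are duplicate-free (the pieces are self-avoiding). -/
theorem tvbits3_nodup : ∀ σ, (tvbits (0, 0) (pc3 σ)).Nodup := by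
  decide +kernel

/-- **The integer site certificate functional of `pc3` equals the bit-mask site functional** on the reward box,
for piece records `RS = (W σ, endpoint, vertex bit list)` and `B ≤ A`. -/
theorem certLHSVz_pc3_eq_certFastMS {k : ℕ} (W : Fin 261 → ℕ) (RS : List (ℕ × (ℤ × ℤ) × List ℕ))
    (hlen : RS.length = 261)
    (hRS : ∀ σ : Fin 261, RS.getD σ (0, (0, 0), []) = (W σ, tr2 (pend (pc3 σ)), tvbits (0, 0) (pc3 σ)))
    {A B : ℕ} (hBA : B ≤ A) (V0t V1t : ℤ × ℤ → ℕ) {y : Fin 2 → ℤ} (hy : y ∈ boxList 2 6) :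
    certLHSVz (fun σ => pend (pc3 σ)) (SV pc3 k) W k A B 7 (fun u => V0t (tr2 u)) (fun u => V1t (tr2 u)) y =
      ((certFastMS RS k A B 7 V0t V1t (tr2 y) (shOfV (tr2 y)) : ℕ) : ℤ) :=
  certLHSVz_eq_certFastMS pc3 RS hlen W hRS tvbits3_nodup length_pc3_le6 k A B 7 hBA length_pc3 V0t V1t
    (abs_le6_of_mem_boxList6 hy).1 (abs_le6_of_mem_boxList6 hy).2

end Summit.CriticalPhenomena.PercolationContinuityZ3.Theorems.Pcint.BSMR
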